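import Literature.AlgebraicGeometry.HodgeTheory.HodgeStructureOfHodgeModelTypeShift
import Literature.AlgebraicGeometry.HodgeTheory.ComplexOrientationCycleClassFacts
import Literature.AlgebraicGeometry.HodgeTheory.ComplexGysinHodgeType
import Literature.AlgebraicGeometry.HodgeTheory.ComplexConjugationHolds
import Literature.AlgebraicGeometry.HodgeTheory.HodgeRiemannPolarizabilityProofs
import Literature.NumberTheory.Transcendental.DeRhamTheoremMultiplicative
import HarnessLib

/-!
# Level-one correspondences factor through Gysin morphisms of surfaces (semisimplicity)

Family `hodge`, layer `Literature/AlgebraicGeometry/HodgeTheory`. The Hodge-theoretic half of the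
implication "GHC(3,1) for a threefold `Y` ⟹ the level-one curve correspondences into `H³(Y)` are
algebraic" (Grothendieck, Topology 8 (1969), p. 301; Abdulali in Kerr–Pearlstein 2016, Ch. 11,
Prop. 3.2): let `gⱼ : Sⱼ ⟶ Y` be finitely many morphisms from smooth projective surfaces to a
smooth projective threefold, `C` a smooth projective curve, and `φ : H¹(C(ℂ); ℂ) → H³(Y(ℂ); ℂ)` a
rational map of type `(1,1)` whose image lies in the sum of the Gysin images
`(gⱼ)_* H¹(Sⱼ(ℂ); ℂ)` (Gysin morphisms of the COMPLEX ORIENTATION family, which preserve rational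
classes). Then `φ = Σⱼ (gⱼ)_* ∘ ψⱼ` for rational maps `ψⱼ : H¹(C(ℂ)) → H¹(Sⱼ(ℂ))` of type `(0,0)`
(`exists_weightOne_factorisation_of_range_le_gysin`).

Proof. Read everything in real Hodge models (`exists_isReal_hodgeModel_holds`; types do not depend
on the model, `hodgePQ_independent_of_hodgeModel_holds`). On the abstract layer, `φ` is a morphism
`H¹(C) → H³(Y)(1)` and `(gⱼ)_*` is a morphism `H¹(Sⱼ) → H³(Y)(1)`
(`HodgeModel.exists_hom_of_typeShift`; the Gysin morphism has bidegree `(1,1)`,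
`isOfHodgeType_complexGysin`, and is rational for the complex orientations,
`isRationalClass_complexGysin_complexOrientationFamily`); `G = Σⱼ (gⱼ)_* ∘ prⱼ : ⊕ⱼ H¹(Sⱼ) → H³(Y)(1)`
is a morphism from a POLARISABLE Hodge structure (`IsPolarizable.pi`,
`smoothProjective_hodgeStructure_isPolarizable_holds`) with `im φ ⊆ im G` (by the hypothesis and
`(I ⊗ ℂ) ∩ V = I`); by the lifting property of polarisable Hodge structures
(`Motives.HodgeStructure.Hom.exists_comp_eq_of_range_le`: semisimplicity + strictness) `φ = G ∘ ψ`
for a morphism `ψ : H¹(C) → ⊕ⱼ H¹(Sⱼ)`, whose components, read back on the carriers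
(`HodgeModel.exists_carrier_of_hom`), are the `ψⱼ`.

Everything is proved; no definition, no named fact.

## References

* [GrothendieckTopology1969] A. Grothendieck, Topology 8 (1969), p. 301.
* [KerrPearlstein2016] Kerr–Pearlstein (eds.), Recent Advances in Hodge Theory, Ch. 11 (Abdulali)
  Prop. 3.2 p. 291.
* [VoisinHodgeI2002] C. Voisin, Hodge Theory and Complex Algebraic Geometry I, §7.3.1 Lemma 7.26,
  §7.3.2.
* [DeligneHodgeII1971] P. Deligne, Théorie de Hodge II, 2.1, Thm. 2.3.5 (iii).
-/

noncomputable section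

open scoped TensorProduct Manifold
open CategoryTheory AlgebraicGeometry
open Literature.AlgebraicTopology.SingularHomology
open Literature.AlgebraicGeometry.Motives (HodgeStructure)

namespace Literature.AlgebraicGeometry.HodgeTheory

section HodgeTheory

/-! ### Small abstract helpers: projections of a direct sum; finite sums of images -/

section Pi

universe w v

variable {ι : Type w} [Fintype ι] [DecidableEq ι]
variable {W : ι → Type v} [∀ j, AddCommGroup (W j)] [∀ j, Module ℚ (W j)] {n : ℤ}

/-- **The projections `⊕ⱼ Hⱼ → Hⱼ` underlie morphisms of Hodge structures** (the filtration of the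
direct sum is componentwise). [cite: DeligneHodgeII1971, 2.1] -/
theorem exists_hom_proj (H : ∀ j, HodgeStructure (W j) n) (j : ι) :
    ∃ π : Motives.HodgeStructure.Hom (Motives.HodgeStructure.pi H) (H j),
      π.toLinearMap = LinearMap.proj j :=
  ⟨{ toLinearMap := LinearMap.proj j
     map_F_le := fun p ↦ by
       rintro _ ⟨x, hx, rfl⟩
       rw [SetLike.mem_coe, Motives.HodgeStructure.mem_pi_F_iff] at hx
       show (LinearMap.proj j : (∀ i, W i) →ₗ[ℚ] W j).baseChange ℂ x ∈ (H j).F p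
       rw [Motives.HodgeStructure.proj_baseChange_apply]
       exact hx j },
    rfl⟩

end Pi

/-- An element of a finite supremum of images is a sum of images (one preimage per index). [folklore] -/
theorem exists_sum_eq_of_mem_iSup_range {ι : Type} [Fintype ι] {M : Type} [AddCommGroup M] [Module ℂ M]
    {N : ι → Type} [∀ j, AddCommGroup (N j)] [∀ j, Module ℂ (N j)] (f : ∀ j, N j →ₗ[ℂ] M) {x : M}
    (hx : x ∈ ⨆ j, LinearMap.range (f j)) : ∃ y : ∀ j, N j, x = ∑ j, f j (y j) := by
  classical
  induction hx using Submodule.iSup_induction' with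
  | mem j x hx =>
    obtain ⟨w, rfl⟩ := hx
    refine ⟨Pi.single j w, ?_⟩
    rw [Finset.sum_eq_single j (fun i _ hij ↦ by rw [Pi.single_eq_of_ne hij, map_zero])
      (fun h ↦ (h (Finset.mem_univ j)).elim), Pi.single_eq_same]
  | zero => exact ⟨0, by simp⟩
  | add x x' _ _ hx hx' =>
    obtain ⟨y, rfl⟩ := hx
    obtain ⟨y', rfl⟩ := hx'
    exact ⟨y + y', by simp [Finset.sum_add_distrib]⟩

/-! ### The factorisation -/

/-- **Level-one correspondences into `Σⱼ (gⱼ)_* H¹(Sⱼ)` factor through the `(gⱼ)_*` by weight-one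
morphisms.** Let `Y` be a smooth projective threefold, `C` a smooth projective curve,
`gⱼ : Sⱼ ⟶ Y` finitely many morphisms from smooth projective surfaces, `A`, `B`, `A'ⱼ` Hodge
models, and `φ : H¹(C(ℂ); ℂ) → H³(Y(ℂ); ℂ)` `ℂ`-linear, mapping rational classes to rational
classes and type `(p, q)` to type `(p + 1, q + 1)`, with
`im φ ⊆ Σⱼ im ((gⱼ)_* : H¹(Sⱼ(ℂ)) → H³(Y(ℂ)))` (Gysin morphisms of `complexOrientationFamily`). Then
there are `ℂ`-linear `ψⱼ : H¹(C(ℂ)) → H¹(Sⱼ(ℂ))`, mapping rational classes to rational classes and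
type `(p, q)` to type `(p, q)`, with `Σⱼ (gⱼ)_* ∘ ψⱼ = φ`. (Semisimplicity of polarisable Hodge
structures: the lifting property `Hom.exists_comp_eq_of_range_le` applied to
`⊕ⱼ H¹(Sⱼ) → H³(Y)(1)`.) [cite: GrothendieckTopology1969, p. 301]
[cite: KerrPearlstein2016, Ch. 11 (Abdulali) Prop. 3.2 p. 291] [cite: VoisinHodgeI2002, §7.3.1 Lemma 7.26 and §7.3.2] -/
theorem exists_weightOne_factorisation_of_range_le_gysin {ι : Type} [Fintype ι]
    {Y C : Motives.SchemeOver ℂ} (hY : Motives.IsSmoothProjective 3 Y)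
    (hC : Motives.IsSmoothProjective 1 C) (A : HodgeModel 3 Y) (B : HodgeModel 1 C)
    {S : ι → Motives.SchemeOver ℂ} (hS : ∀ j, Motives.IsSmoothProjective 2 (S j)) (g : ∀ j, S j ⟶ Y)
    (A' : ∀ j, HodgeModel 2 (S j)) (φ : complexBetti C 1 →ₗ[ℂ] complexBetti Y 3)
    (hφ : ∀ c, IsRationalClass c → IsRationalClass (φ c))
    (hφH : ∀ (p q : ℕ), p + q = 1 → ∀ c, B.pullback 1 c ∈ B.hodgePQ 1 p q →
      A.pullback 3 (φ c) ∈ A.hodgePQ 3 (p + 1) (q + 1))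
    (hle : LinearMap.range φ ≤ ⨆ j, LinearMap.range
      (complexGysin complexOrientationFamily (hS j) hY (g j) (show 1 + 2 * 3 = 3 + 2 * 2 from rfl))) :
    ∃ ψ : ∀ j, complexBetti C 1 →ₗ[ℂ] complexBetti (S j) 1,
      (∀ j c, IsRationalClass c → IsRationalClass (ψ j c)) ∧
      (∀ j (p q : ℕ), p + q = 1 → ∀ c, B.pullback 1 c ∈ B.hodgePQ 1 p q →
        (A' j).pullback 1 (ψ j c) ∈ (A' j).hodgePQ 1 (p + 0) (q + 0)) ∧
      ∑ j, complexGysin complexOrientationFamily (hS j) hY (g j)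
        (show 1 + 2 * 3 = 3 + 2 * 2 from rfl) ∘ₗ ψ j = φ := by
  classical
  set μ₀ : OrientationFamily := complexOrientationFamily with hμ₀
  have h13 : 1 + 2 * 3 = 3 + 2 * 2 := rfl
  set f : ∀ j, complexBetti (S j) 1 →ₗ[ℂ] complexBetti Y 3 :=
    fun j ↦ complexGysin μ₀ (hS j) hY (g j) h13 with hfdef
  -- 1. real models
  obtain ⟨A₀, hA₀r⟩ := exists_isReal_hodgeModel_holds 3 Y hY
  obtain ⟨B₀, hB₀r⟩ := exists_isReal_hodgeModel_holds 1 C hC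
  have hA'₀ : ∀ j, ∃ A'₀ : HodgeModel 2 (S j), A'₀.IsReal := fun j ↦ exists_isReal_hodgeModel_holds 2 (S j) (hS j)
  choose A'₀ hA'₀r using hA'₀
  have hA₀ := hA₀r.isHodgeSymmetric
  have hB₀ := hB₀r.isHodgeSymmetric
  have hA'₀s : ∀ j, (A'₀ j).IsHodgeSymmetric := fun j ↦ (hA'₀r j).isHodgeSymmetric
  -- types transferred to the real models
  have hI := hodgePQ_independent_of_hodgeModel_holds
  have hφH₀ : ∀ (p q : ℕ), p + q = 1 → ∀ c, B₀.pullback 1 c ∈ B₀.hodgePQ 1 p q →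
      A₀.pullback 3 (φ c) ∈ A₀.hodgePQ 3 (p + 1) (q + 1) := fun p q hpq c hc ↦
    hI 3 Y hY A A₀ 3 _ _ _ (hφH p q hpq c (hI 1 C hC B₀ B 1 _ _ _ hc))
  -- the Gysin morphisms: rational, bidegree `(1,1)`
  have hfrat : ∀ j c, IsRationalClass c → IsRationalClass (f j c) := fun j c hc ↦
    isRationalClass_complexGysin_complexOrientationFamily (hS j) hY (g j) h13 hc
  have hfH : ∀ j (p q : ℕ), p + q = 1 → ∀ c, (A'₀ j).pullback 1 c ∈ (A'₀ j).hodgePQ 1 p q →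
      A₀.pullback 3 (f j c) ∈ A₀.hodgePQ 3 (p + 1) (q + 1) := by
    intro j p q hpq c hc
    have hy : IsOfHodgeType 2 (S j) 1 p q c := ⟨A'₀ j, hc⟩
    obtain ⟨A'', hA''⟩ := isOfHodgeType_complexGysin hI
      (fun m Y ↦ nonempty_hodgeModel_holds)
      (fun E _ _ _ ↦ Literature.NumberTheory.Transcendental.exists_deRhamIsoFamily_holds E)
      μ₀ (hS j) hY (g j) h13 (p' := p + 1) (q' := q + 1) (by omega) (by omega) hy
    exact hI 3 Y hY A'' A₀ 3 _ _ _ hA''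
  -- 2. finite-dimensionality
  haveI hfinS : ∀ j, Module.Finite ℚ (Motives.bettiCohomology (S j) 1) := fun j ↦ by
    letI := (hS j).chartedSpace
    haveI := Motives.ComplexPoints.compactSpace_of_isSmoothProjective (hS j)
    haveI := Motives.ComplexPoints.t2Space_of_isSmoothProjective (hS j)
    exact finite_singularCohomology_of_compact_chartedSpace ℚ ℚ (d := 2 * 2) 1
  -- 3. the abstract structures
  have hw : (((3 : ℕ) : ℕ) : ℤ) - 2 * ((1 : ℕ) : ℤ) = (((1 : ℕ) : ℕ) : ℤ) := by norm_num
  set T : HodgeStructure (Motives.bettiCohomology Y 3) (((1 : ℕ) : ℕ) : ℤ) :=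
    ((A₀.hodgeStructure hY hA₀ 3).tateTwist ((1 : ℕ) : ℤ)).cast hw with hTdef
  have hT : ∀ p q : ℤ, T.piece p q = (A₀.hodgeStructure hY hA₀ 3).piece (p + (1 : ℕ)) (q + (1 : ℕ)) :=
    fun p q ↦ HodgeModel.piece_tateTwist_cast hY A₀ hA₀ hw p q
  set HS : ∀ j, HodgeStructure (Motives.bettiCohomology (S j) 1) (((1 : ℕ) : ℕ) : ℤ) :=
    fun j ↦ (A'₀ j).hodgeStructure (hS j) (hA'₀s j) 1 with hHSdef
  set HC : HodgeStructure (Motives.bettiCohomology C 1) (((1 : ℕ) : ℕ) : ℤ) :=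
    B₀.hodgeStructure hC hB₀ 1 with hHCdef
  -- `φ` and the `(gⱼ)_*` as morphisms into `T = H³(Y)(1)`
  obtain ⟨φq, hφq⟩ := HodgeModel.exists_hom_of_typeShift hC hY B₀ hB₀ A₀ hA₀ (show 1 + 2 * 1 = 3 from rfl)
    T hT φ hφ hφH₀
  have hGq : ∀ j, ∃ Gq : Motives.HodgeStructure.Hom (HS j) T,
      ∀ x, Motives.ofRatClassBaseChange (Motives.ComplexPoints Y) 3 (Gq.toLinearMap.baseChange ℂ x) =
        f j (Motives.ofRatClassBaseChange (Motives.ComplexPoints (S j)) 1 x) := fun j ↦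
    HodgeModel.exists_hom_of_typeShift (hS j) hY (A'₀ j) (hA'₀s j) A₀ hA₀ (show 1 + 2 * 1 = 3 from rfl)
      T hT (f j) (hfrat j) (hfH j)
  choose Gq hGq using hGq
  set G : Motives.HodgeStructure.Hom (Motives.HodgeStructure.pi HS) T := Motives.HodgeStructure.Hom.piDesc Gq
    with hGdef
  -- polarisability of the source
  have hpol : (Motives.HodgeStructure.pi HS).IsPolarizable :=
    Motives.HodgeStructure.IsPolarizable.pi fun j ↦
      smoothProjective_hodgeStructure_isPolarizable_holds (hS j) (A'₀ j) (hA'₀s j) 1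
  -- 4. `im φq ⊆ im G`
  set βY := ofRatClassBaseChangeEquiv hY 3 with hβY
  set βC := ofRatClassBaseChangeEquiv hC 1 with hβC
  set βS := fun j ↦ ofRatClassBaseChangeEquiv (hS j) 1 with hβS
  have hGbc : ∀ z, G.toLinearMap.baseChange ℂ z =
      ∑ j, (Gq j).toLinearMap.baseChange ℂ ((LinearMap.proj j : (∀ i, Motives.bettiCohomology (S i) 1) →ₗ[ℚ]
        Motives.bettiCohomology (S j) 1).baseChange ℂ z) := by
    intro z
    rw [hGdef]
    change ((∑ j, (Gq j).toLinearMap ∘ₗ LinearMap.proj j).baseChange ℂ) z = _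
    rw [Motives.HodgeStructure.baseChange_finset_sum, LinearMap.sum_apply]
    refine Finset.sum_congr rfl fun j _ ↦ ?_
    rw [LinearMap.baseChange_comp, LinearMap.comp_apply]
  have hrange : LinearMap.range φq.toLinearMap ≤ LinearMap.range G.toLinearMap := by
    rintro _ ⟨u, rfl⟩
    apply Motives.HodgeStructure.mem_of_ofRat_mem_baseChange
    rw [← Motives.HodgeStructure.range_baseChange]
    -- `φ (u ⊗ 1) = Σⱼ fⱼ yⱼ`
    have hmem : φ (ofRatClass (Motives.ComplexPoints C) 1 u) ∈ ⨆ j, LinearMap.range (f j) :=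
      hle ⟨_, rfl⟩
    obtain ⟨y, hy⟩ := exists_sum_eq_of_mem_iSup_range f hmem
    set z : ℂ ⊗[ℚ] (∀ j, Motives.bettiCohomology (S j) 1) :=
      (Motives.HodgeStructure.piEquiv _).symm fun j ↦ (βS j).symm (y j) with hz
    refine ⟨z, ?_⟩
    apply βY.injective
    rw [hβY, ofRatClassBaseChangeEquiv_apply, ofRatClassBaseChangeEquiv_apply,
      ← Motives.HodgeStructure.baseChange_ofRat φq.toLinearMap u, hφq, ofRatClassBaseChange_ofRat, hy,
      hGbc, map_sum]
    refine Finset.sum_congr rfl fun j _ ↦ ?_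
    rw [Motives.HodgeStructure.proj_baseChange_apply, hz, LinearEquiv.apply_symm_apply, hGq,
      ← ofRatClassBaseChangeEquiv_apply (hS j) 1, LinearEquiv.apply_symm_apply]
  -- 5. the lift
  obtain ⟨ψq, hψq⟩ := Motives.HodgeStructure.Hom.exists_comp_eq_of_range_le hpol G φq hrange
  have hψq' : G.toLinearMap ∘ₗ ψq.toLinearMap = φq.toLinearMap := by
    rw [← Motives.HodgeStructure.Hom.comp_toLinearMap', hψq]
  -- components and their carrier maps
  have hπ := fun j ↦ exists_hom_proj HS j
  choose π hπ using hπ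
  have hcar := fun j ↦ HodgeModel.exists_carrier_of_hom hC (hS j) B₀ hB₀ (A'₀ j) (hA'₀s j)
    (show 1 + 2 * 0 = 1 from rfl) (HS j) (fun p q ↦ by simp only [hHSdef, Nat.cast_zero, add_zero])
    ((π j).comp ψq)
  choose ψ hψc hψrat hψH using hcar
  refine ⟨ψ, hψrat, fun j p q hpq c hc ↦ ?_, ?_⟩
  · -- types, transferred back to the given models
    exact hI 2 (S j) (hS j) (A'₀ j) (A' j) 1 _ _ _ (hψH j p q hpq c (hI 1 C hC B B₀ 1 _ _ _ hc))
  · -- `Σⱼ fⱼ ∘ ψⱼ = φ`, checked on `β_C x`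
    apply LinearMap.ext
    intro c
    obtain ⟨x, rfl⟩ := ofRatClassBaseChange_surjective hC 1 c
    rw [LinearMap.sum_apply, ← hφq, ← hψq', LinearMap.baseChange_comp, LinearMap.comp_apply, hGbc, map_sum]
    refine Finset.sum_congr rfl fun j _ ↦ ?_
    rw [LinearMap.comp_apply, ← hψc j, hGq]
    congr 2
    rw [Motives.HodgeStructure.Hom.comp_toLinearMap', hπ, LinearMap.baseChange_comp, LinearMap.comp_apply]

end HodgeTheory

end Literature.AlgebraicGeometry.HodgeTheory

end
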